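import Summits.Ventures.PercRepro.C026HubFamily

/-!
# PercRepro — the extended hub families (Theorem′ / Theorem″) are minor-closed (p1, gen 5; lead (jk)(6))

mine-3's Theorem′ / Theorem″ (`proofs/MINE3-HUB-theorem.md`, extensions): C-026 holds at every `p` when
the neighbourhood of ONE mark is hub-like — every non-mark neighbour of that mark is adjacent only to the
marks — and the rest of the graph is arbitrary.  Here the family is typed (`IsMarkHubGraph a b c m`, for a
chosen mark `m ∈ {a, b, c}`) and proved closed under marked minors with distinct new marks, so
`c026_of_family` (`C026HubFamily.lean`) applies: C-026 at every `p` on the family follows from the reduced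
class positivity on it (`c026_markHub_of_reduced`) — the hypothesis half (b) would discharge for it.

The closure argument: along sure edges from `m`, the first step reaches a non-mark neighbour `h` of `m`
(a mark would merge two marks), which is hub-like, so the next step reaches a mark again — hence the sure
class of `m` is `m` together with hub-like neighbours (`mem_sureClass_mark`); a hub-like non-mark `x` has
only marks as sure neighbours, so its class is `{x}` (`eq_of_conn_of_isHubLike`); an edge of the minor from
the class of `m` to a non-mark class therefore comes from an edge `m–x` with `x` hub-like, and every edge
of the minor at the class `{x}` comes from an edge at `x`, whose other endpoint is a mark.
-/

namespace PercRepro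

/-- `x` is one of the marks `a, b, c`. -/
def IsMark {V : Type*} (a b c x : V) : Prop := x = a ∨ x = b ∨ x = c

/-- The image of a mark under a map is a mark for the image marks. -/
theorem IsMark.map {V W : Type*} {a b c x : V} (h : IsMark a b c x) (g : V → W) :
    IsMark (g a) (g b) (g c) (g x) := by
  rcases h with h | h | h
  · exact Or.inl (congrArg g h)
  · exact Or.inr (Or.inl (congrArg g h))
  · exact Or.inr (Or.inr (congrArg g h))

namespace MultiGraph

variable {V E : Type*} (G : MultiGraph V E)

/-- **Hub-like**: every edge at `x` has its other endpoint among the marks. -/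
def IsHubLike (a b c x : V) : Prop :=
  ∀ f, (G.fst f = x → IsMark a b c (G.snd f)) ∧ (G.snd f = x → IsMark a b c (G.fst f))

/-- **The family of Theorem′ / Theorem″**: every non-mark neighbour of the mark `m` is hub-like. -/
def IsMarkHubGraph (a b c m : V) : Prop :=
  ∀ f, (G.fst f = m → ¬ IsMark a b c (G.snd f) → G.IsHubLike a b c (G.snd f)) ∧
    (G.snd f = m → ¬ IsMark a b c (G.fst f) → G.IsHubLike a b c (G.fst f))

variable {G}

/-- **A hub-like non-mark has a singleton sure class** when its class is not a mark's class: a sure edge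
at it would lead to a mark. -/
theorem eq_of_conn_of_isHubLike {a b c x : V} (v : Config E) (hx : G.IsHubLike a b c x)
    (hX : ¬ IsMark (G.sureClass v a) (G.sureClass v b) (G.sureClass v c) (G.sureClass v x))
    {y : V} (hy : G.Conn v x y) : y = x := by
  refine Conn.induction (motive := fun w => w = x) rfl ?_ hy
  intro w z _ hwz hw
  subst hw
  obtain ⟨f, hf, hend⟩ := hwz
  exfalso
  have hz : IsMark a b c z := by
    rcases hend with ⟨h1, h2⟩ | ⟨h1, h2⟩
    · have := (hx f).1 h1
      rwa [h2] at this
    · have := (hx f).2 h2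
      rwa [h1] at this
  have hconn : G.Conn v w z := Conn.of_openAdj ⟨f, hf, hend⟩
  apply hX
  rw [(G.sureClass_eq_iff v w z).2 hconn]
  exact hz.map (G.sureClass v)

/-- **The sure class of the mark `m`** (when no other mark is sure-connected to `m`) consists of `m` and
hub-like non-mark neighbours of `m`. -/
theorem mem_sureClass_mark {a b c m : V} (v : Config E) (hG : G.IsMarkHubGraph a b c m)
    (hinj : ∀ y, IsMark a b c y → G.Conn v m y → y = m) {w : V} (hw : G.Conn v m w) :
    w = m ∨ (¬ IsMark a b c w ∧ G.IsHubLike a b c w) := by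
  refine Conn.induction (motive := fun w => w = m ∨ (¬ IsMark a b c w ∧ G.IsHubLike a b c w))
    (Or.inl rfl) ?_ hw
  intro w z hmw hwz ih
  obtain ⟨f, hf, hend⟩ := hwz
  have hmz : G.Conn v m z := hmw.trans (Conn.of_openAdj ⟨f, hf, hend⟩)
  by_cases hz : IsMark a b c z
  · exact Or.inl (hinj z hz hmz)
  · right
    refine ⟨hz, ?_⟩
    rcases ih with rfl | ⟨-, hwh⟩
    · rcases hend with ⟨h1, h2⟩ | ⟨h1, h2⟩
      · have := (hG f).1 h1 (by rw [h2]; exact hz)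
        rwa [h2] at this
      · have := (hG f).2 h2 (by rw [h1]; exact hz)
        rwa [h1] at this
    · exfalso
      rcases hend with ⟨h1, h2⟩ | ⟨h1, h2⟩
      · have := (hwh f).1 h1
        rw [h2] at this
        exact hz this
      · have := (hwh f).2 h2
        rw [h1] at this
        exact hz this

/-- **The extended hub family is closed under marked minors with distinct new marks.** -/
theorem IsMarkHubGraph.minor {a b c m : V} (hG : G.IsMarkHubGraph a b c m) (hm : IsMark a b c m)
    (u v : Config E)
    (hinj : Function.Injective ![G.sureClass v a, G.sureClass v b, G.sureClass v c]) :
    (G.minor u v).IsMarkHubGraph (G.sureClass v a) (G.sureClass v b) (G.sureClass v c)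
      (G.sureClass v m) := by
  have hAB : G.sureClass v a ≠ G.sureClass v b := fun h =>
    absurd (hinj (show ![G.sureClass v a, G.sureClass v b, G.sureClass v c] 0 =
      ![G.sureClass v a, G.sureClass v b, G.sureClass v c] 1 from h)) (by decide)
  have hAC : G.sureClass v a ≠ G.sureClass v c := fun h =>
    absurd (hinj (show ![G.sureClass v a, G.sureClass v b, G.sureClass v c] 0 =
      ![G.sureClass v a, G.sureClass v b, G.sureClass v c] 2 from h)) (by decide)
  have hBC : G.sureClass v b ≠ G.sureClass v c := fun h =>
    absurd (hinj (show ![G.sureClass v a, G.sureClass v b, G.sureClass v c] 1 =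
      ![G.sureClass v a, G.sureClass v b, G.sureClass v c] 2 from h)) (by decide)
  -- a mark sure-connected to `m` is `m`
  have hinj' : ∀ y, IsMark a b c y → G.Conn v m y → y = m := by
    intro y hy hmy
    have hcl : G.sureClass v m = G.sureClass v y := (G.sureClass_eq_iff v m y).2 hmy
    rcases hm with hm | hm | hm <;> rcases hy with hy | hy | hy <;>
      first
      | exact hy.trans hm.symm
      | exact absurd (by rw [← hm, ← hy]; exact hcl) hAB
      | exact absurd (by rw [← hm, ← hy]; exact hcl) hAB.symm
      | exact absurd (by rw [← hm, ← hy]; exact hcl) hAC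
      | exact absurd (by rw [← hm, ← hy]; exact hcl) hAC.symm
      | exact absurd (by rw [← hm, ← hy]; exact hcl) hBC
      | exact absurd (by rw [← hm, ← hy]; exact hcl) hBC.symm
  -- a non-mark joined by an edge to the sure class of `m` is hub-like
  have hub_of : ∀ w x : V, G.Conn v m w →
      (∃ f : E, (G.fst f = w ∧ G.snd f = x) ∨ (G.fst f = x ∧ G.snd f = w)) →
      ¬ IsMark a b c x → G.IsHubLike a b c x := by
    intro w x hmw hf hx
    obtain ⟨f, hf⟩ := hf
    rcases mem_sureClass_mark v hG hinj' hmw with rfl | ⟨-, hwh⟩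
    · rcases hf with ⟨h1, h2⟩ | ⟨h1, h2⟩
      · have := (hG f).1 h1 (by rw [h2]; exact hx)
        rwa [h2] at this
      · have := (hG f).2 h2 (by rw [h1]; exact hx)
        rwa [h1] at this
    · exfalso
      rcases hf with ⟨h1, h2⟩ | ⟨h1, h2⟩
      · have := (hwh f).1 h1
        rw [h2] at this
        exact hx this
      · have := (hwh f).2 h2
        rw [h1] at this
        exact hx this
  -- a hub-like non-mark stays hub-like in the minor
  have hublike_minor : ∀ x : V, G.IsHubLike a b c x →
      ¬ IsMark (G.sureClass v a) (G.sureClass v b) (G.sureClass v c) (G.sureClass v x) →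
      (G.minor u v).IsHubLike (G.sureClass v a) (G.sureClass v b) (G.sureClass v c)
        (G.sureClass v x) := by
    intro x hx hX g
    constructor
    · intro hg
      have h1 : G.fst g.1 = x :=
        eq_of_conn_of_isHubLike v hx hX ((G.sureClass_eq_iff v x _).1 hg.symm)
      exact ((hx g.1).1 h1).map (G.sureClass v)
    · intro hg
      have h1 : G.snd g.1 = x :=
        eq_of_conn_of_isHubLike v hx hX ((G.sureClass_eq_iff v x _).1 hg.symm)
      exact ((hx g.1).2 h1).map (G.sureClass v)
  intro f
  constructor
  · intro h1 h2
    have hmw : G.Conn v m (G.fst f.1) := (G.sureClass_eq_iff v m _).1 h1.symm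
    have hx : ¬ IsMark a b c (G.snd f.1) := fun h => h2 (h.map (G.sureClass v))
    exact hublike_minor _ (hub_of _ _ hmw ⟨f.1, Or.inl ⟨rfl, rfl⟩⟩ hx) h2
  · intro h1 h2
    have hmw : G.Conn v m (G.snd f.1) := (G.sureClass_eq_iff v m _).1 h1.symm
    have hx : ¬ IsMark a b c (G.fst f.1) := fun h => h2 (h.map (G.sureClass v))
    exact hublike_minor _ (hub_of _ _ hmw ⟨f.1, Or.inr ⟨rfl, rfl⟩⟩ hx) h2

end MultiGraph

/-! ### The families and their C-026 -/

/-- The family «the neighbourhood of `c` is hub-like» (mine-3's Theorem′). -/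
def cHubFamily : MarkedFamily := fun G a b c => G.IsMarkHubGraph a b c c

/-- The family «the neighbourhood of `b` is hub-like» (mine-3's Theorem″). -/
def bHubFamily : MarkedFamily := fun G a b c => G.IsMarkHubGraph a b c b

/-- The family «the neighbourhood of `a` is hub-like» (Theorem″ with the roles of `a` and `b` swapped). -/
def aHubFamily : MarkedFamily := fun G a b c => G.IsMarkHubGraph a b c a

/-- `cHubFamily` is minor-closed. -/
theorem cHubFamily_minorClosed : cHubFamily.MinorClosed :=
  fun _ _ _ _ u v hG hinj => MultiGraph.IsMarkHubGraph.minor hG (Or.inr (Or.inr rfl)) u v hinj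

/-- `bHubFamily` is minor-closed. -/
theorem bHubFamily_minorClosed : bHubFamily.MinorClosed :=
  fun _ _ _ _ u v hG hinj => MultiGraph.IsMarkHubGraph.minor hG (Or.inr (Or.inl rfl)) u v hinj

/-- `aHubFamily` is minor-closed. -/
theorem aHubFamily_minorClosed : aHubFamily.MinorClosed :=
  fun _ _ _ _ u v hG hinj => MultiGraph.IsMarkHubGraph.minor hG (Or.inl rfl) u v hinj

/-- **C-026 at every `p` when the neighbourhood of `c` is hub-like, given the reduced class positivity on
that family** (the shape of mine-3's Theorem′). -/
theorem c026_cHub_of_reduced (h : cHubFamily.ReducedClassPositive) {V E : Type} [Fintype V]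
    [Fintype E] [DecidableEq E] (G : MultiGraph V E) {a b c : V} (hG : G.IsMarkHubGraph a b c c)
    (p : E → ℝ) (hp : IsProb p) :
    (G.law3 p a b c 0 + G.law3 p a b c 1) * (G.law3 p a b c 1 + G.law3 p a b c 4) ≤
      G.law3 p a b c 1 + G.law3 p a b c 2 + G.law3 p a b c 3 :=
  c026_of_family cHubFamily cHubFamily_minorClosed h G hG p hp

/-- **C-026 at every `p` when the neighbourhood of `b` is hub-like, given the reduced class positivity on
that family** (the shape of mine-3's Theorem″). -/
theorem c026_bHub_of_reduced (h : bHubFamily.ReducedClassPositive) {V E : Type} [Fintype V]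
    [Fintype E] [DecidableEq E] (G : MultiGraph V E) {a b c : V} (hG : G.IsMarkHubGraph a b c b)
    (p : E → ℝ) (hp : IsProb p) :
    (G.law3 p a b c 0 + G.law3 p a b c 1) * (G.law3 p a b c 1 + G.law3 p a b c 4) ≤
      G.law3 p a b c 1 + G.law3 p a b c 2 + G.law3 p a b c 3 :=
  c026_of_family bHubFamily bHubFamily_minorClosed h G hG p hp

end PercRepro
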